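import Literature.Algebra.Polynomial.CasasAlvero.Trinomial
import Literature.Algebra.Polynomial.CasasAlvero.Degree5
import Literature.Algebra.Polynomial.CasasAlvero.MoreBadPrimes
import Literature.Algebra.Polynomial.CasasAlvero.Degree8CharPMore
import Literature.Algebra.Polynomial.CasasAlvero.DigitReduction
import HarnessLib

/-!
# Casas-Alvero degrees in characteristic 19: the complete classification

Over EVERY field `K` of characteristic `19`: `CA_d(K) ⟺ d = 0 ∨ d = a·19^k` with `1 ≤ a ≤ 5`.
Ingredients: the digit reduction `CA_d ⇒ d = a·p^k ∧ CA_a` (`DigitReduction.lean`, any field); the positive digits `1, 2, 3, 4`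
([GrafVonBothmerEtAl2007, Props. 2, 6], degree `≤ 4`) and `5` (`Degree5.lean`: `19` is not one of the nine bad primes of degree 5,
and `CA_{5·p^k}` descends from the algebraic closure); and a refutation of every digit `6 ≤ a ≤ 18`:
`6, 10, 12, 13, 14, 15, 18` by the binomial criterion (`binom(a,m) ≡ 1 (mod 19)` for `m = 3, 4, 4, 3, 6, 5, 2`);
`7` by the degree-7 bad-prime table (`p ≤ 61`); `8, 9` by the explicit `𝔽_19`-examples of `Degree8CharPMore.lean`, `MoreBadPrimes.lean`;
`11, 16, 17` by the trinomials of `Trinomial.lean` (`X^11 + X^3 + 7X^2`, `X^16 - 4X^10 + 3X^2`, `X^17 + 4X^4 + X`).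
This is the first prime `p > 13` with a complete classification in this directory (characteristic `17` hinges on the digit `6`,
which is a Casas-Alvero digit there by [CastryckLaterveerOunaies2012, Thm. 4] but has no formal proof yet).
-/

noncomputable section

open Polynomial

namespace Literature.Algebra.Polynomial.CasasAlvero

variable (K : Type*) [Field K] [CharP K 19]

/-- `CA_{5·19^k}` over every field of characteristic `19`. [cite: CastryckLaterveerOunaies2012, Thm. 4]
[cite: GrafVonBothmerEtAl2007, Prop. 6] -/
theorem holdsInDegree_five_mul_nineteen_pow (k : ℕ) : HoldsInDegree K (5 * 19 ^ k) := by
  haveI : Fact (Nat.Prime 19) := ⟨by norm_num⟩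
  exact holdsInDegree_five_mul_prime_pow_field K 19 (by norm_num) (by norm_num) (by norm_num) (by norm_num)
    (by norm_num) (by norm_num) (by norm_num) (by norm_num) (by norm_num) k

/-- every digit `6 ≤ a < 19` fails: `¬ CA_a` over every field of characteristic `19`. [folklore] -/
theorem not_holdsInDegree_digit_of_char_nineteen {a : ℕ} (h6 : 6 ≤ a) (hap : a < 19) : ¬ HoldsInDegree K a := by
  haveI : Fact (Nat.Prime 19) := ⟨by norm_num⟩
  interval_cases a
  · exact not_holdsInDegree_of_choose_modEq_one K 19 (d := 6) (m := 3) (by norm_num) (by norm_num) (by decide)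
  · exact not_holdsInDegree_seven_of_le K 19 (by norm_num) (by norm_num)
  · exact not_holdsInDegree_eight_of_char_19 K
  · exact not_holdsInDegree_nine_of_char_19 K
  · exact not_holdsInDegree_of_choose_modEq_one K 19 (d := 10) (m := 4) (by norm_num) (by norm_num) (by decide)
  · exact not_holdsInDegree_eleven_of_char_19 K
  · exact not_holdsInDegree_of_choose_modEq_one K 19 (d := 12) (m := 4) (by norm_num) (by norm_num) (by decide)
  · exact not_holdsInDegree_of_choose_modEq_one K 19 (d := 13) (m := 3) (by norm_num) (by norm_num) (by decide)
  · exact not_holdsInDegree_of_choose_modEq_one K 19 (d := 14) (m := 6) (by norm_num) (by norm_num) (by decide)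
  · exact not_holdsInDegree_of_choose_modEq_one K 19 (d := 15) (m := 5) (by norm_num) (by norm_num) (by decide)
  · exact not_holdsInDegree_sixteen_of_char_19 K
  · exact not_holdsInDegree_seventeen_of_char_19 K
  · exact not_holdsInDegree_of_choose_modEq_one K 19 (d := 18) (m := 2) (by norm_num) (by norm_num) (by decide)

/-- **characteristic 19, complete**: over every field of characteristic `19`,
`CA_d ⟺ d = 0 ∨ d = a·19^k` with `1 ≤ a ≤ 5`. [cite: GrafVonBothmerEtAl2007, Props. 2, 6, 7]
[cite: CastryckLaterveerOunaies2012, Thm. 4] -/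
theorem classification_char_nineteen_complete (d : ℕ) :
    HoldsInDegree K d ↔ d = 0 ∨ ∃ k a : ℕ, 0 < a ∧ a ≤ 5 ∧ d = a * 19 ^ k := by
  haveI : Fact (Nat.Prime 19) := ⟨by norm_num⟩
  constructor
  · intro h
    rcases Nat.eq_zero_or_pos d with rfl | hd
    · exact Or.inl rfl
    obtain ⟨k, a, ha0, hap, rfl, ha⟩ := digit_of_holdsInDegree K 19 hd.ne' h
    refine Or.inr ⟨k, a, ha0, ?_, rfl⟩
    by_contra h5
    exact not_holdsInDegree_digit_of_char_nineteen K (by omega) hap ha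
  · rintro (rfl | ⟨k, a, ha0, ha5, rfl⟩)
    · exact holdsInDegree_zero K
    · interval_cases a
      · simpa using holdsInDegree_prime_pow_field K 19 k
      · exact holdsInDegree_two_mul_prime_pow_field K 19 k
      · exact holdsInDegree_three_mul_prime_pow_field K 19 (by norm_num) k
      · exact holdsInDegree_mul_prime_pow_field K 19
          (holdsInDegree_of_le_four_of_charP (AlgebraicClosure K) 19 (by norm_num) le_rfl) k
      · exact holdsInDegree_five_mul_nineteen_pow K k

/-- the set of Casas-Alvero degrees `≤ 361` in characteristic `19`, explicitly. [folklore] -/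
theorem holdsInDegree_iff_mem_of_le_char_nineteen_sq {d : ℕ} (hd : d ≤ 361) :
    HoldsInDegree K d ↔ d ∈ ({0, 1, 2, 3, 4, 5, 19, 38, 57, 76, 95, 361} : Finset ℕ) := by
  rw [classification_char_nineteen_complete]
  constructor
  · rintro (rfl | ⟨k, a, ha0, ha5, rfl⟩)
    · decide
    · rcases k with _ | _ | _ | k
      · interval_cases a <;> decide
      · interval_cases a <;> decide
      · interval_cases a <;> simp_all
      · exfalso
        have : 19 ^ 3 ≤ a * 19 ^ (k + 1 + 1 + 1) :=
          le_trans (Nat.pow_le_pow_right (by norm_num) (by omega)) (Nat.le_mul_of_pos_left _ ha0)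
        omega
  · intro h
    simp only [Finset.mem_insert, Finset.mem_singleton] at h
    rcases h with rfl | rfl | rfl | rfl | rfl | rfl | rfl | rfl | rfl | rfl | rfl | rfl
    · exact Or.inl rfl
    · exact Or.inr ⟨0, 1, by norm_num, by norm_num, by norm_num⟩
    · exact Or.inr ⟨0, 2, by norm_num, by norm_num, by norm_num⟩
    · exact Or.inr ⟨0, 3, by norm_num, by norm_num, by norm_num⟩
    · exact Or.inr ⟨0, 4, by norm_num, by norm_num, by norm_num⟩
    · exact Or.inr ⟨0, 5, by norm_num, by norm_num, by norm_num⟩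
    · exact Or.inr ⟨1, 1, by norm_num, by norm_num, by norm_num⟩
    · exact Or.inr ⟨1, 2, by norm_num, by norm_num, by norm_num⟩
    · exact Or.inr ⟨1, 3, by norm_num, by norm_num, by norm_num⟩
    · exact Or.inr ⟨1, 4, by norm_num, by norm_num, by norm_num⟩
    · exact Or.inr ⟨1, 5, by norm_num, by norm_num, by norm_num⟩
    · exact Or.inr ⟨2, 1, by norm_num, by norm_num, by norm_num⟩

end Literature.Algebra.Polynomial.CasasAlvero
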